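import Literature.Probability.RandomPlanarGeometry.HexSAWStripSurfaceArchCut
import Literature.Probability.RandomPlanarGeometry.HexParafermionWeighted
import HarnessLib

/-!
# The Duminil-Copin–Smirnov strip identity WITH A SURFACE FUGACITY: BBdGDCG 2014, Proposition 4 at `n = 0`

Topic `Literature/Probability/RandomPlanarGeometry` (continues `HexSAWLemma2.lean` — DCS's Lemma 2 `1 = c_α A + B + c_ε E` on the
strips `stripV T L`, the classes `IsAlphaDart/IsBetaDart/IsEpsDart`, their windings and boundary terms — and
`HexParafermionWeighted.lean` — the vertex relation with a surface weight, `boundary_sum_weighted_upper` — and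
`HexSAWStripSurfaceArchCut.lean`, whose vocabulary `surfContacts`/`stripGFy` this file uses).  Source: N. R. Beaton,
M. Bousquet-Mélou, J. de Gier, H. Duminil-Copin, A. J. Guttmann, *The critical fugacity for surface adsorption of self-avoiding
walks on the honeycomb lattice is `1 + √2`* (Theorem 2), Comm. Math. Phys. 326 (2014) 727–754 (arXiv:1109.0358v5), §3 Proposition 4 =
eq. (11) (v5 p. 7; the global identity with fugacity `y` on the `β` boundary; Lemma 3 p. 4 = the weighted local identity) and §4.1
eq. (16) (p. 13): at `n = 0`, dilute branch `x_c^{-1} = 2cos(π/8)`,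
"`1 = α A_{T,L}(x_c, y) + ε E_{T,L}(x_c, y) + β(y) B_{T,L}(x_c, y)`, `α = cos(3π/8)`, `ε = cos(π/4)`,
`β(y) = (y* - y)/(y(y* - 1)) = (1 + √2 - y)/(√2 y)`, `y* = 1 + √2`"; §4.2 in the arXiv v1 (2011) wording "If, in addition,
`y < y*`, the coefficients are positive … `A_{T,L}`, `B_{T,L}` … are bounded" (the v5 = CMP text, p. 14, runs this argument at
`y = y*` only — "Since the coefficients α and ε are positive, the above identity shows that A_{T,L}(x_c; y*) remains bounded as L
increases" — and takes the `y < y_T` limits from Corollary 8, p. 12; page numbers below are arXiv v5 throughout).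

## What is proved (HOME build of a-p2 g7, 2026-08-23; face Y1′ of the door R96′ «HEX-YC-DCS» of a-idea-1 gen 17, the DCS-frame twin of R96)

Label: CONSOLIDATION — printed identity with printed proof (the surface vertices' defect `(1 - y)`, BBdGDCG v5 pp. 7–8), one
step simplified: BBdGDCG combine the two arrival directions (SW/SE) by the mirror symmetry of the strip before taking real parts;
here each direction is evaluated separately and both have real part `-cos(π/8)`, so no symmetry is needed.  NO parity
hypothesis (unlike Beaton's rotated Prop. 6): refute-first numerics `dcs_identity_y_check.py` (7 strips × 5 values of `y`,
residual ≤ 3e-14).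

* over the vocabulary of `HexSAWStripSurfaceArchCut` (`surfContacts T P` = `c(γ)` = inner vertices on the top level `2T - 1`,
  `stripGFy T L cls y` = `Σ x_c^ℓ y^c`): `surfContacts_eq_countP`, `stripGFy_eps_one`, `stripTop`, `swt_stripTop`;
* `boundary_sum_stripY`, `classSum_stripY` (`c_α A(y) + B(y) + c_ε E(y) = 1 + (1 - y) Re(𝔇/e₀)`);
* first arrivals at the top level `arrTopS` (from SW or SE only), `stripG`, `defectS_eq_sum`, Hopf `pturn_of_arrTopS` (`∓1`),
  `arrTermS_re` (`-cos(π/8)`), `defectS_re`; `stripGFy_beta_eq` (`B(y) = x_c y G(y)`);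
* **`strip_identityY_master`** (`c_α A + B + c_ε E + (1 - y) cos(π/8) G = 1`, all real `y`) and **`strip_identityY`** —
  BBdGDCG Prop. 4 at `n = 0`: `cos(3π/8) A(y) + ((1 + √2 - y)/(√2 y)) B(y) + cos(π/4) E(y) = 1` (`T ≥ 1`, `y > 0`);
* `stripGFy_beta_le` — for `0 < y < 1 + √2`: `B_{T,L}(x_c, y) ≤ √2 y/(1 + √2 - y)` (the boundedness used in §4.2);
* the door's typed faces closed by name: `yStar`, `betaY`, `betaY_one`, `StripIdentityY` + `stripIdentityY_holds` (Y1′),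
  `StripByBound` + `stripByBound_holds` (Y-LOWER′, eq. (17)).
-/

noncomputable section

namespace Literature.Probability.RandomPlanarGeometry.SAW

namespace HV

open Finset Real Complex

/-! ### Surface contacts on the top level of `S_{T,L}` (vocabulary of `HexSAWStripSurfaceArchCut`: `surfContacts`, `stripGFy`) -/

/-- `c(γ)` as a count: `surfContacts T P = #{inner vertices on the top level 2T - 1}`.
[cite: BeatonBousquetMelouDeGierDuminilCopinGuttmann2014, §2 (arXiv v5 p. 5: weight y per contact with the surface)] -/
theorem surfContacts_eq_countP (T : ℕ) (P : List HV) :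
    surfContacts T P = (inner P).countP (fun v => lev v = 2 * (T : ℤ) - 1) := by
  rw [surfContacts, List.countP_eq_length_filter]

/-- At `y = 1`: `E(1) = E_{T,L}(x_c)` (companions `stripGFy_alpha_one`, `stripGFy_beta_one`). [cite: DuminilCopinSmirnov2012, §3] -/
theorem stripGFy_eps_one (T L : ℕ) : stripGFy T L (IsEpsDart L) 1 = stripE T L hexCriticalFugacity := by
  simp [stripGFy, stripE]

/-- The surface set: the top level of `S_{T,L}`. [cite: BeatonBousquetMelouDeGierDuminilCopinGuttmann2014, §2 (the β boundary)] -/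
def stripTop (T L : ℕ) : Finset HV := (stripV T L).filter (fun v => lev v = 2 * (T : ℤ) - 1)

/-- On walks of `S_{T,L}` the generic surface weight for `S = stripTop T L` is `y^{c(γ)}`.
[cite: BeatonBousquetMelouDeGierDuminilCopinGuttmann2014, §2] -/
theorem swt_stripTop {T L : ℕ} {P : List HV} (hP : IsMidWalk (stripV T L) P) (y : ℝ) :
    swt (stripTop T L) (y : ℂ) P = ((y ^ surfContacts T P : ℝ) : ℂ) := by
  rw [swt, surfContacts_eq_countP, Complex.ofReal_pow]
  congr 1
  refine List.countP_congr fun v hv => ?_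
  have hvV : v ∈ stripV T L := hP.2.2.2.1 v hv
  simp [stripTop, hvV]

/-! ### The weighted boundary sum and the class sorting -/

/-- **The weighted boundary sum on `S_{T,L}`**: `Σ_{exits} edir·x_c^ℓλ^W·y^c = e₀ + (1 - y)·𝔇`, `𝔇` the top-level defect.
[cite: BeatonBousquetMelouDeGierDuminilCopinGuttmann2014, proof of Proposition 4 (S computed two ways)] -/
theorem boundary_sum_stripY {T L : ℕ} (hT : 1 ≤ T) (y : ℝ) :
    ∑ P ∈ (midWalks (stripV T L)).filter (fun P => P ≠ [wOut, hvOrigin] ∧ (finalDart P).2 ∉ stripV T L),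
      edir (finalDart P).1 (finalDart P).2 * pwt P * swt (stripTop T L) (y : ℂ) P =
    emb (-1, 2) + (1 - (y : ℂ)) *
      ∑ v ∈ (stripV T L).filter (· ∈ stripTop T L), ∑ P ∈ clsIn (stripV T L) v,
        edir v (finalDart P).1 * pwt P * swt (stripTop T L) (y : ℂ) P := by
  rw [← edir_wOut_hvOrigin]
  exact boundary_sum_weighted_upper stripV_upper (hvOrigin_mem_stripV hT) _ _

/-- **The exits sorted into DCS's classes, with the fugacity riding along**:
`cos(3π/8) A(y) + B(y) + cos(π/4) E(y) = 1 + (1 - y) Re(𝔇/e₀)` (`T ≥ 1`). [cite: BeatonBousquetMelouDeGierDuminilCopinGuttmann2014, proof of Proposition 4 ("any mid-edge p not belonging to ∂D_{T,L} … contributes 0")] [cite: DuminilCopinSmirnov2012, proof of Lemma 2] -/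
theorem classSum_stripY {T L : ℕ} (hT : 1 ≤ T) (y : ℝ) :
    Real.cos (3 * π / 8) * stripGFy T L IsAlphaDart y + stripGFy T L (IsBetaDart T) y +
        Real.cos (π / 4) * stripGFy T L (IsEpsDart L) y =
      1 + (1 - y) * ((∑ v ∈ (stripV T L).filter (· ∈ stripTop T L), ∑ P ∈ clsIn (stripV T L) v,
        edir v (finalDart P).1 * pwt P * swt (stripTop T L) (y : ℂ) P) / emb (-1, 2)).re := by
  have hbs := boundary_sum_stripY (L := L) hT y
  rw [sum_filter] at hbs
  set D := ∑ v ∈ (stripV T L).filter (· ∈ stripTop T L), ∑ P ∈ clsIn (stripV T L) v,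
        edir v (finalDart P).1 * pwt P * swt (stripTop T L) (y : ℂ) P with hD
  -- pointwise sorting of the real part of each term divided by `e₀`
  have hpt : ∀ P ∈ midWalks (stripV T L),
      ((if P ≠ [wOut, hvOrigin] ∧ (finalDart P).2 ∉ stripV T L then
          edir (finalDart P).1 (finalDart P).2 * pwt P * swt (stripTop T L) (y : ℂ) P else 0) / emb (-1, 2)).re =
        hexCriticalFugacity ^ mwLen P * y ^ surfContacts T P *
          ((if IsAlphaDart (finalDart P) then Real.cos (3 * π / 8) else 0) +
            (if IsBetaDart T (finalDart P) then 1 else 0) +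
            (if IsEpsDart L (finalDart P) then Real.cos (π / 4) else 0)) := by
    intro P hP
    rw [mem_midWalks_iff] at hP
    have hiff := boundary_iff hT hP
    have hre : ∀ z : ℂ, (z * pwt P * swt (stripTop T L) (y : ℂ) P / emb (-1, 2)).re =
        hexCriticalFugacity ^ mwLen P * y ^ surfContacts T P * (z * lam ^ pturn P / emb (-1, 2)).re := by
      intro z
      rw [swt_stripTop hP, pwt, show z * ((hexCriticalFugacity : ℂ) ^ mwLen P * lam ^ pturn P) *
          ((y ^ surfContacts T P : ℝ) : ℂ) / emb (-1, 2) =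
          ((hexCriticalFugacity ^ mwLen P * y ^ surfContacts T P : ℝ) : ℂ) * (z * lam ^ pturn P / emb (-1, 2)) by
          push_cast; ring, Complex.re_ofReal_mul]
    by_cases hα : IsAlphaDart (finalDart P)
    · rw [if_pos (hiff.2 (Or.inl hα)), hre, boundaryTerm_re_of_isAlphaDart hP hα, if_pos hα,
        if_neg (not_isBetaDart_of_isAlphaDart hα), if_neg (not_isEpsDart_of_isAlphaDart hα)]
      ring
    by_cases hβ : IsBetaDart T (finalDart P)
    · rw [if_pos (hiff.2 (Or.inr (Or.inl hβ))), hre, boundaryTerm_of_isBetaDart hP hβ,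
        Complex.one_re, if_neg hα, if_pos hβ, if_neg (not_isEpsDart_of_isBetaDart hβ)]
      ring
    by_cases hε : IsEpsDart L (finalDart P)
    · rw [if_pos (hiff.2 (Or.inr (Or.inr hε))), hre, boundaryTerm_re_of_isEpsDart hP hε,
        if_neg hα, if_neg hβ, if_pos hε]
      ring
    · rw [if_neg (by rw [hiff]; push Not; exact ⟨hα, hβ, hε⟩), zero_div, Complex.zero_re,
        if_neg hα, if_neg hβ, if_neg hε]
      ring
  have key := congrArg (fun z => (z / emb (-1, 2)).re) hbs
  have hfix : ((1 - (y : ℂ)) * D / emb (-1, 2)).re = (1 - y) * (D / emb (-1, 2)).re := by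
    rw [mul_div_assoc, show (1 - (y : ℂ)) = ((1 - y : ℝ) : ℂ) by push_cast; ring, Complex.re_ofReal_mul]
  rw [Finset.sum_div, Complex.re_sum, Finset.sum_congr rfl hpt, add_div, div_self emb_neg_one_two_ne_zero,
    Complex.add_re, Complex.one_re, hfix] at key
  have hA : ∑ P ∈ midWalks (stripV T L), hexCriticalFugacity ^ mwLen P * y ^ surfContacts T P *
      (if IsAlphaDart (finalDart P) then Real.cos (3 * π / 8) else 0) =
        Real.cos (3 * π / 8) * stripGFy T L IsAlphaDart y := by
    rw [stripGFy, Finset.mul_sum, Finset.sum_filter]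
    refine Finset.sum_congr rfl fun P _ => ?_
    split_ifs <;> ring
  have hB : ∑ P ∈ midWalks (stripV T L), hexCriticalFugacity ^ mwLen P * y ^ surfContacts T P *
      (if IsBetaDart T (finalDart P) then (1 : ℝ) else 0) = stripGFy T L (IsBetaDart T) y := by
    rw [stripGFy, Finset.sum_filter]
    refine Finset.sum_congr rfl fun P _ => ?_
    split_ifs <;> ring
  have hE : ∑ P ∈ midWalks (stripV T L), hexCriticalFugacity ^ mwLen P * y ^ surfContacts T P *
      (if IsEpsDart L (finalDart P) then Real.cos (π / 4) else 0) =
        Real.cos (π / 4) * stripGFy T L (IsEpsDart L) y := by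
    rw [stripGFy, Finset.mul_sum, Finset.sum_filter]
    refine Finset.sum_congr rfl fun P _ => ?_
    split_ifs <;> ring
  rw [← hA, ← hB, ← hE, ← key, ← Finset.sum_add_distrib, ← Finset.sum_add_distrib]
  refine Finset.sum_congr rfl fun P _ => ?_
  ring

/-! ### First arrivals at the top level (BBdGDCG's walks `a ⇝ q, p` / `a ⇝ r, p`): index set and re-indexing -/

/-- First arrivals at a top-level vertex of `S_{T,L}` (the walk reaches a `β` vertex, not visited before; the arrival is
from the SW or the SE neighbour). [cite: BeatonBousquetMelouDeGierDuminilCopinGuttmann2014, proof of Proposition 4 ("q (resp. r) stands for the SW (resp. SE) mid-edge adjacent to v")] -/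
def arrTopS (T L : ℕ) : Finset (List HV) :=
  (midWalks (stripV T L)).filter fun P =>
    (finalDart P).2 ∈ stripV T L ∧ lev (finalDart P).2 = 2 * (T : ℤ) - 1 ∧ (finalDart P).2 ∉ inner P

/-- `G(y) := Σ_{first arrivals at the top level} x_c^ℓ y^c` (BBdGDCG's `Σ_{p ∈ β, γ : a ⇝ q,p} + Σ_{… r,p}`).
[cite: BeatonBousquetMelouDeGierDuminilCopinGuttmann2014, proof of Proposition 4] -/
def stripG (T L : ℕ) (y : ℝ) : ℝ := ∑ P ∈ arrTopS T L, hexCriticalFugacity ^ mwLen P * y ^ surfContacts T P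

/-- Re-indexing the top-level defect as a sum over first arrivals. [cite: BeatonBousquetMelouDeGierDuminilCopinGuttmann2014, proof of Proposition 4] -/
theorem defectS_eq_sum {T L : ℕ} (f : HV → List HV → ℂ) :
    ∑ v ∈ (stripV T L).filter (· ∈ stripTop T L), ∑ P ∈ clsIn (stripV T L) v, f v P =
      ∑ P ∈ arrTopS T L, f (finalDart P).2 P := by
  classical
  set V := stripV T L with hV
  have h1 : ∑ v ∈ V.filter (· ∈ stripTop T L), ∑ P ∈ clsIn V v, f v P =
      ∑ P ∈ midWalks V, ∑ v ∈ V.filter (· ∈ stripTop T L),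
        (if (finalDart P).2 = v ∧ v ∉ inner P then f v P else 0) := by
    rw [sum_comm]
    refine sum_congr rfl fun v _ => ?_
    rw [clsIn, sum_filter]
  have h2 : ∀ P ∈ midWalks V, ∑ v ∈ V.filter (· ∈ stripTop T L),
      (if (finalDart P).2 = v ∧ v ∉ inner P then f v P else 0) =
      if (finalDart P).2 ∈ V.filter (· ∈ stripTop T L) ∧ (finalDart P).2 ∉ inner P then f (finalDart P).2 P else 0 := by
    intro P _
    have : ∀ v ∈ V.filter (· ∈ stripTop T L), (if (finalDart P).2 = v ∧ v ∉ inner P then f v P else 0) =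
        if (finalDart P).2 = v then (if (finalDart P).2 ∉ inner P then f (finalDart P).2 P else 0) else 0 := by
      intro v _
      by_cases h : (finalDart P).2 = v
      · subst h; by_cases h' : (finalDart P).2 ∉ inner P <;> simp [h']
      · simp [h]
    rw [sum_congr rfl this, sum_ite_eq]
    by_cases ha : (finalDart P).2 ∈ V.filter (· ∈ stripTop T L) <;>
      by_cases hb : (finalDart P).2 ∉ inner P <;> simp [ha, hb]
  rw [h1, sum_congr rfl h2, ← sum_filter]
  congr 1
  ext P
  simp only [arrTopS, ← hV, mem_filter, stripTop]
  constructor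
  · rintro ⟨hP, ⟨⟨hv2, -, hx⟩, hni⟩⟩; exact ⟨hP, hv2, hx, hni⟩
  · rintro ⟨hP, hv2, hx, hni⟩
    exact ⟨hP, ⟨hv2, by rw [hV] at hv2; exact hv2, hx⟩, hni⟩

/-- Unpacking a first arrival at the top level: `P = a⁻ :: (l ++ [u])`, `u = (a, T-1, ↑)` on the top level, `u ∉ l`, arriving
from `t = (a, T-1, ↓)` (SW) or `t = (a+1, T-1, ↓)` (SE) — the third neighbour `(a, T, ↓)` is outside `S_{T,L}`.
[cite: BeatonBousquetMelouDeGierDuminilCopinGuttmann2014, proof of Proposition 4] -/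
private theorem arrTopS_anatomy {T L : ℕ} {P : List HV} (hP : P ∈ arrTopS T L) :
    ∃ (l : List HV) (u : HV) (hl : l ≠ []), P = wOut :: (l ++ [u]) ∧ IsMidWalk (stripV T L) P ∧
      u ∈ stripV T L ∧ u.2.2 = true ∧ u.2.1 = (T : ℤ) - 1 ∧ u ∉ l ∧ hvGraph.Adj (l.getLast hl) u ∧
      finalDart P = (l.getLast hl, u) ∧ (l.getLast hl).2.2 = false ∧ (l.getLast hl).2.1 = (T : ℤ) - 1 ∧
      ((l.getLast hl).1 = u.1 ∨ (l.getLast hl).1 = u.1 + 1) := by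
  simp only [arrTopS, mem_filter, mem_midWalks_iff] at hP
  obtain ⟨hPw, hu2, hlev, hni⟩ := hP
  have hne : P ≠ [wOut, hvOrigin] := by
    rintro rfl
    rw [finalDart_trivial] at hlev
    simp [hvOrigin, lev, bit] at hlev
    omega
  rcases hPw.trivial_or_exists with rfl | ⟨l, u, hl, rfl⟩
  · exact absurd rfl hne
  rw [finalDart_cons_append hl] at hu2 hlev hni ⊢
  rw [inner_cons_append] at hni
  dsimp only at hu2 hlev hni
  obtain ⟨-, -, hadj, hlV, -, -⟩ := (isMidWalk_cons_append_iff _ hl u).1 hPw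
  have htV : l.getLast hl ∈ stripV T L := hlV _ (List.getLast_mem hl)
  obtain ⟨ua, ub, uc⟩ := u
  have hulev := hlev
  simp only [lev, bit] at hulev
  have huc : uc = true := by
    cases uc
    · simp at hulev; omega
    · rfl
  subst huc
  simp only [if_true] at hulev
  have hub : ub = (T : ℤ) - 1 := by omega
  have key : (l.getLast hl).2.2 = false ∧ (l.getLast hl).2.1 = (T : ℤ) - 1 ∧
      ((l.getLast hl).1 = ua ∨ (l.getLast hl).1 = ua + 1) := by
    have ht := mem_stripV_iff.1 htV
    revert hadj ht
    generalize l.getLast hl = t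
    intro hadj ht
    obtain ⟨ta, tb, tc⟩ := t
    cases tc <;> simp [hvGraph_adj, AdjRel, lev, bit] at hadj ht ⊢
    omega
  exact ⟨l, (ua, ub, true), hl, rfl, hPw, hu2, rfl, hub, hni, hadj, rfl, key.1, key.2.1, key.2.2⟩

/-- `emb(1,1) = √3·e^{iπ/6}` (the NE edge of the tree's picture) and `emb(-2,1) = √3·e^{5iπ/6}` (the NW edge). [folklore] -/
private theorem emb_arrival_dirs :
    emb (1, 1) = (Real.sqrt 3 : ℂ) * Complex.exp ((π / 6 : ℝ) * I) ∧
    emb (-2, 1) = (Real.sqrt 3 : ℂ) * Complex.exp ((5 * π / 6 : ℝ) * I) := by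
  have h3 : Real.sqrt 3 * Real.sqrt 3 = 3 := Real.mul_self_sqrt (by norm_num)
  have c5 : Real.cos (5 * π / 6) = -(Real.sqrt 3 / 2) := by
    rw [show 5 * π / 6 = π - π / 6 by ring, Real.cos_pi_sub, Real.cos_pi_div_six]
  have s5 : Real.sin (5 * π / 6) = 1 / 2 := by
    rw [show 5 * π / 6 = π - π / 6 by ring, Real.sin_pi_sub, Real.sin_pi_div_six]
  constructor
  · apply Complex.ext
    · rw [emb_re, Complex.re_ofReal_mul, Complex.exp_ofReal_mul_I_re, Real.cos_pi_div_six]; push_cast; nlinarith [h3]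
    · rw [emb_im, Complex.im_ofReal_mul, Complex.exp_ofReal_mul_I_im, Real.sin_pi_div_six]; push_cast; ring
  · apply Complex.ext
    · rw [emb_re, Complex.re_ofReal_mul, Complex.exp_ofReal_mul_I_re, c5]; push_cast; nlinarith [h3]
    · rw [emb_im, Complex.im_ofReal_mul, Complex.exp_ofReal_mul_I_im, s5]; push_cast; ring

/-- `arg emb(1,1) = π/6`, `arg emb(-2,1) = 5π/6`. [folklore] -/
private theorem arg_arrival_dirs : Complex.arg (emb (1, 1)) = π / 6 ∧ Complex.arg (emb (-2, 1)) = 5 * π / 6 := by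
  obtain ⟨h1, h2⟩ := emb_arrival_dirs
  have hs : (0 : ℝ) < Real.sqrt 3 := Real.sqrt_pos.2 (by norm_num)
  constructor
  · rw [h1, Complex.arg_real_mul _ hs, Complex.arg_exp_mul_I, toIocMod_eq_self]
    constructor <;> linarith [Real.pi_pos]
  · rw [h2, Complex.arg_real_mul _ hs, Complex.arg_exp_mul_I, toIocMod_eq_self]
    constructor <;> linarith [Real.pi_pos]

/-- **Winding of a first arrival at the top level**: `pturn = -1` arriving from the SW (NE step), `+1` from the SE (NW step) —
Hopf (`hopf_path_eval`, `c₁ = c₂ = 1`): the arrival vertex is a highest point of the strip, the chord terms cancel.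
[cite: BeatonBousquetMelouDeGierDuminilCopinGuttmann2014, proof of Proposition 4 (the factors λ̄, λ of the two arrival directions); DuminilCopinSmirnov2012, proof of Lemma 2 (Hopf)] -/
theorem pturn_of_arrTopS {T L : ℕ} {P : List HV} (hP : P ∈ arrTopS T L) :
    pturn P = if (finalDart P).1.1 = (finalDart P).2.1 then -1 else 1 := by
  obtain ⟨l, u, hl, rfl, hPw, huV, huc, hub, hul, hadj, hfd, htc, htb, hta⟩ := arrTopS_anatomy hP
  obtain ⟨-, hh, -, hlV, hnd, -⟩ := (isMidWalk_cons_append_iff _ hl u).1 hPw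
  rw [hfd]
  dsimp only
  have hwl : wOut ∉ l := fun h => wOut_not_mem_stripV T L (hlV _ h)
  have huw : u ≠ wOut := fun h => wOut_not_mem_stripV T L (h ▸ huV)
  have hPnd : (wOut :: (l ++ [u])).Nodup := by
    rw [List.nodup_cons, List.mem_append, List.mem_singleton, not_or]
    exact ⟨⟨hwl, Ne.symm huw⟩, hnd.append (List.nodup_singleton u) (List.disjoint_singleton.2 hul)⟩
  have hlen : (wOut :: (l ++ [u])).length = l.length + 2 := by simp
  have hposu : (pos u).2 = 3 * (T : ℤ) - 1 := by
    obtain ⟨a, b, c⟩ := u; simp only at huc hub; subst huc; simp [pos]; omega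
  have htop : ∀ x ∈ stripV T L, (pos x).2 ≤ 3 * (T : ℤ) - 1 := by
    intro x hx
    have h := (mem_stripV_iff.1 hx).2.1
    obtain ⟨a, b, c⟩ := x; cases c <;> simp [pos, lev, bit] at h ⊢ <;> omega
  have hu1 : 1 ≤ (pos u).2 := one_le_pos_snd (stripV_upper _ huV)
  have hentry : ∀ i ≤ l.length + 1, -1 ≤ (pos ((wOut :: (l ++ [u])).getD i hvOrigin)).2 ∧
      (pos ((wOut :: (l ++ [u])).getD i hvOrigin)).2 ≤ (pos u).2 := by
    intro i hi
    rcases getD_walk_mem hi u with h | h | h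
    · rw [h, pos_wOut]; exact ⟨le_rfl, by omega⟩
    · have h1 := htop _ (hlV _ h)
      have h2 := one_le_pos_snd (stripV_upper _ (hlV _ h))
      exact ⟨by omega, le_of_le_of_eq h1 hposu.symm⟩
    · rw [h]; exact ⟨by omega, le_rfl⟩
  have key := hopf_path_eval hPw.1 hPnd hlen one_ne_zero one_ne_zero ?_ ?_
  · simp only [one_mul] at key
    rw [getD_walk_last, getD_walk_prev hl, List.getD_cons_zero, getD_walk_one hh,
      edir_wOut_hvOrigin, arg_emb_neg_one_two] at key
    obtain ⟨a1, a2⟩ := arg_arrival_dirs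
    have hπ : (0 : ℝ) < π / 3 := by positivity
    -- the arrival edge vector
    have hvec : edir (l.getLast hl) u = if (l.getLast hl).1 = u.1 then emb (1, 1) else emb (-2, 1) := by
      obtain ⟨a, b, c⟩ := u
      simp only at huc hub
      subst huc
      rw [edir]
      generalize l.getLast hl = t at htc htb hta ⊢
      obtain ⟨ta, tb, tc⟩ := t
      simp only at htc htb hta ⊢
      subst htc
      have hbb : tb = b := by omega
      subst hbb
      rcases hta with h | h
      · rw [h, if_pos rfl]; simp [pos]
      · rw [h, if_neg (by omega)]; simp [pos]; ring_nf
    by_cases hc : (l.getLast hl).1 = u.1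
    · rw [if_pos hc]
      rw [hvec, if_pos hc, a1] at key
      have : (π / 3) * (pturn (wOut :: (l ++ [u])) : ℝ) = (π / 3) * (-1 : ℤ) := by push_cast; linarith
      exact_mod_cast mul_left_cancel₀ hπ.ne' this
    · rw [if_neg hc]
      rw [hvec, if_neg hc, a2] at key
      have : (π / 3) * (pturn (wOut :: (l ++ [u])) : ℝ) = (π / 3) * (1 : ℤ) := by push_cast; linarith
      exact_mod_cast mul_left_cancel₀ hπ.ne' this
  · intro i hi
    rw [one_mul, List.getD_cons_zero, edir, emb_im, Prod.snd_sub, pos_wOut]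
    have := (hentry i hi).1
    have : (0 : ℝ) ≤ (((pos ((wOut :: (l ++ [u])).getD i hvOrigin)).2 - (-1 : ℤ) : ℤ) : ℝ) := by
      exact_mod_cast (by omega)
    positivity
  · intro i hi
    rw [one_mul, getD_walk_last, edir, emb_im, Prod.snd_sub]
    have := (hentry i hi).2
    have : (0 : ℝ) ≤ (((pos u).2 - (pos ((wOut :: (l ++ [u])).getD i hvOrigin)).2 : ℤ) : ℝ) := by
      exact_mod_cast (by omega)
    positivity

/-- `Re(λ¹⁵) = Re(-λ⁹) = -cos(π/8)`. [folklore] -/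
private theorem re_lam_15_and_9 : (lam ^ (15 : ℤ)).re = -Real.cos (π / 8) ∧ (-lam ^ (9 : ℤ)).re = -Real.cos (π / 8) := by
  constructor
  · rw [lam_zpow, Complex.exp_ofReal_mul_I_re,
      show ((15 : ℤ) : ℝ) * θ₅ = (π - π / 8) - (2 : ℤ) * (2 * π) by rw [θ₅]; push_cast; ring,
      Real.cos_sub_int_mul_two_pi, Real.cos_pi_sub]
  · rw [Complex.neg_re, lam_zpow, Complex.exp_ofReal_mul_I_re,
      show ((9 : ℤ) : ℝ) * θ₅ = (π / 8) - (1 : ℤ) * (2 * π) by rw [θ₅]; push_cast; ring,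
      Real.cos_sub_int_mul_two_pi]

/-- **The arrival term**: for a first arrival at the top level, `Re[(u - t)·λ^{W}/e₀]` with the direction REVERSED (as it
enters the defect of the vertex relation at `v = u`) is `-cos(π/8)` for both arrival directions (`λ¹⁵` from the SW,
`-λ⁹` from the SE — a mirror pair). [cite: BeatonBousquetMelouDeGierDuminilCopinGuttmann2014, proof of Proposition 4 ("e^{-5iπ/6}λ̄ + e^{-iπ/6}λ = -2i cos((π±θ)/4)")] -/
theorem arrTermS_re {T L : ℕ} {P : List HV} (hP : P ∈ arrTopS T L) :
    (edir (finalDart P).2 (finalDart P).1 * lam ^ pturn P / emb (-1, 2)).re = -Real.cos (π / 8) := by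
  have hpt := pturn_of_arrTopS hP
  obtain ⟨l, u, hl, rfl, hPw, huV, huc, hub, hul, hadj, hfd, htc, htb, hta⟩ := arrTopS_anatomy hP
  rw [hfd] at hpt ⊢
  dsimp only at hpt ⊢
  obtain ⟨r15, r9⟩ := re_lam_15_and_9
  have h8 : lam ^ (8 : ℤ) = omg := lam_zpow_eight
  have hvec : edir u (l.getLast hl) = if (l.getLast hl).1 = u.1 then emb (-1, -1) else emb (2, -1) := by
    obtain ⟨a, b, c⟩ := u
    simp only at huc hub
    subst huc
    rw [edir]
    generalize l.getLast hl = t at htc htb hta ⊢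
    obtain ⟨ta, tb, tc⟩ := t
    simp only at htc htb hta ⊢
    subst htc
    have hbb : tb = b := by omega
    subst hbb
    rcases hta with h | h
    · rw [h, if_pos rfl]; simp [pos]
    · rw [h, if_neg (by omega)]; simp [pos]; ring_nf
  have e16 : omg ^ 2 = lam ^ (16 : ℤ) := by
    rw [← h8, ← zpow_natCast, ← zpow_mul]; norm_num
  by_cases hc : (l.getLast hl).1 = u.1
  · rw [if_pos hc] at hpt hvec
    rw [hvec, hpt, emb_neg_one_neg_one, mul_right_comm, mul_div_assoc, div_self emb_neg_one_two_ne_zero, mul_one, e16,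
      ← zpow_add₀ lam_ne_zero, show (16 : ℤ) + -1 = 15 by norm_num, r15]
  · rw [if_neg hc] at hpt hvec
    rw [hvec, hpt, emb_two_neg_one, mul_right_comm, mul_div_assoc, div_self emb_neg_one_two_ne_zero, mul_one, ← h8,
      neg_mul, ← zpow_add₀ lam_ne_zero, show (8 : ℤ) + 1 = 9 by norm_num, r9]

/-- **The top-level defect evaluated**: `Re(𝔇/e₀) = -cos(π/8)·G(y)`. [cite: BeatonBousquetMelouDeGierDuminilCopinGuttmann2014, proof of Proposition 4 (2S = -i(1-y)(x y)^{-1}cos((π±θ)/4) B_{T,L})] -/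
theorem defectS_re {T L : ℕ} (y : ℝ) :
    ((∑ v ∈ (stripV T L).filter (· ∈ stripTop T L), ∑ P ∈ clsIn (stripV T L) v,
        edir v (finalDart P).1 * pwt P * swt (stripTop T L) (y : ℂ) P) / emb (-1, 2)).re =
      -Real.cos (π / 8) * stripG T L y := by
  rw [defectS_eq_sum (fun v P => edir v (finalDart P).1 * pwt P * swt (stripTop T L) (y : ℂ) P), sum_div, Complex.re_sum,
    stripG, mul_sum]
  refine sum_congr rfl fun P hP => ?_
  have hPw : IsMidWalk (stripV T L) P := mem_midWalks_iff.1 (mem_filter.1 hP).1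
  rw [swt_stripTop hPw, pwt, show edir (finalDart P).2 (finalDart P).1 *
      ((hexCriticalFugacity : ℂ) ^ mwLen P * lam ^ pturn P) * ((y ^ surfContacts T P : ℝ) : ℂ) / emb (-1, 2) =
      ((hexCriticalFugacity ^ mwLen P * y ^ surfContacts T P : ℝ) : ℂ) *
        (edir (finalDart P).2 (finalDart P).1 * lam ^ pturn P / emb (-1, 2)) by push_cast; ring,
    Complex.re_ofReal_mul, arrTermS_re hP]
  ring

/-! ### `B(y) = x_c y G(y)` and the identity -/

/-- The `β` exit out of a first arrival at the top level: append the outer vertex above.  It is a walk of `S_{T,L}` ending on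
`β`, one vertex longer, with one more surface contact. [cite: BeatonBousquetMelouDeGierDuminilCopinGuttmann2014, proof of Proposition 4 ("by symmetry … B_{T,L}(x,y)")] -/
theorem betaExit_of_arrTopS {T L : ℕ} {P : List HV} (hP : P ∈ arrTopS T L) :
    IsMidWalk (stripV T L) (P ++ [((finalDart P).2.1, (finalDart P).2.2.1 + 1, false)]) ∧
      IsBetaDart T (finalDart (P ++ [((finalDart P).2.1, (finalDart P).2.2.1 + 1, false)])) ∧
      mwLen (P ++ [((finalDart P).2.1, (finalDart P).2.2.1 + 1, false)]) = mwLen P + 1 ∧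
      surfContacts T (P ++ [((finalDart P).2.1, (finalDart P).2.2.1 + 1, false)]) = surfContacts T P + 1 := by
  have hP' := hP
  simp only [arrTopS, mem_filter, mem_midWalks_iff] at hP'
  obtain ⟨hPw, hv2, hlev, hni⟩ := hP'
  obtain ⟨l, u, hl, hPeq, -, huV, huc, hub, hul, hadj, hfd, htc, htb, -⟩ := arrTopS_anatomy hP
  have hfd2 : (finalDart P).2 = u := by rw [hfd]
  rw [hfd2]
  have hadj' : hvGraph.Adj u (u.1, u.2.1 + 1, false) := by
    obtain ⟨a, b, c⟩ := u; simp only at huc; subst huc; rw [hvGraph_adj]; simp [AdjRel]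
  have hne : (u.1, u.2.1 + 1, false) ≠ (finalDart P).1 := by
    rw [hfd]; dsimp only; intro h; have := congrArg (fun v : HV => v.2.1) h; simp only at this; omega
  obtain ⟨hQ, hfdQ, hlen, hinner⟩ := hPw.append_singleton hfd2 huV (hfd2 ▸ hni) hadj' hne
  refine ⟨hQ, ?_, hlen, ?_⟩
  · rw [hfdQ]; exact ⟨hub, huc, rfl⟩
  · rw [surfContacts_eq_countP, surfContacts_eq_countP, hinner, List.countP_append]
    have hlu : lev u = 2 * (T : ℤ) - 1 := by rw [← hfd2]; exact hlev
    simp [hlu]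

/-- **`B(y) = x_c y G(y)`**: the walks of `S_{T,L}` to `β` are in bijection with the first arrivals at the top level (drop /
append the vertical step out), the weight gaining `x_c y`. [cite: BeatonBousquetMelouDeGierDuminilCopinGuttmann2014, proof of Proposition 4 (B_{T,L}(x,y) = 2 x y Σ_{γ : a ⇝ q,p} x^{|γ|} y^{c(γ)})] -/
theorem stripGFy_beta_eq {T L : ℕ} (hT : 1 ≤ T) (y : ℝ) :
    stripGFy T L (IsBetaDart T) y = hexCriticalFugacity * y * stripG T L y := by
  classical
  set V := stripV T L with hV
  set Φ : List HV → List HV := fun P => P ++ [((finalDart P).2.1, (finalDart P).2.2.1 + 1, false)] with hΦ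
  have hw : wOut ∉ V := wOut_not_mem_stripV T L
  have himage : (midWalks V).filter (fun Q => IsBetaDart T (finalDart Q)) = (arrTopS T L).image Φ := by
    ext Q
    simp only [mem_filter, mem_image, mem_midWalks_iff]
    constructor
    · rintro ⟨hQ, hβ⟩
      obtain ⟨h1, h2, h3⟩ := hβ
      have hQne : Q ≠ [wOut, hvOrigin] := by
        rintro rfl; rw [finalDart_trivial] at h1; simp [wOut] at h1; omega
      have hvV : (finalDart Q).1 ∈ V := finalDart_fst_mem hQ hQne
      obtain ⟨hQ', hf2, hni, -, -⟩ := hQ.dropLast_spec hw hvV rfl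
      have hQnil : Q ≠ [] := by rintro rfl; exact absurd hQ.two_le_length (by simp)
      have hlast : (finalDart Q).2 = Q.getLast hQnil := by
        simp only [finalDart, List.getLast?_eq_some_getLast hQnil, Option.getD_some]
      refine ⟨Q.dropLast, ?_, ?_⟩
      · simp only [arrTopS, mem_filter, mem_midWalks_iff, hf2, ← hV]
        refine ⟨hQ', hvV, ?_, hni⟩
        simp only [lev, bit, h2, if_true, h1]; ring
      · rw [hΦ]
        dsimp only
        rw [hf2, ← h3, hlast, List.dropLast_append_getLast hQnil]
    · rintro ⟨P, hPA, rfl⟩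
      obtain ⟨hQ, hβ, -, -⟩ := betaExit_of_arrTopS hPA
      exact ⟨hQ, hβ⟩
  have hinj : Set.InjOn Φ (arrTopS T L) := fun P _ P' _ h => by
    simpa [hΦ, List.dropLast_concat] using congrArg List.dropLast h
  rw [stripGFy, himage, sum_image hinj, stripG, mul_sum]
  refine sum_congr rfl fun P hP => ?_
  obtain ⟨-, -, hlen, hc⟩ := betaExit_of_arrTopS hP
  simp only [hΦ] at hlen hc ⊢
  rw [hlen, hc, pow_succ, pow_succ]
  ring

/-- **The surface-fugacity identity on `S_{T,L}`, division-free master form** (`T ≥ 1`, every real `y`):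
`cos(3π/8) A(y) + B(y) + cos(π/4) E(y) + (1 - y) cos(π/8) G(y) = 1`, with `B(y) = x_c y G(y)` (`stripGFy_beta_eq`); at `y = 1`
this is DCS's Lemma 2. [cite: BeatonBousquetMelouDeGierDuminilCopinGuttmann2014, Proposition 4 eq. (11) and its proof (arXiv:1109.0358v5 pp. 7–8)] -/
theorem strip_identityY_master {T L : ℕ} (hT : 1 ≤ T) (y : ℝ) :
    Real.cos (3 * π / 8) * stripGFy T L IsAlphaDart y + stripGFy T L (IsBetaDart T) y +
        Real.cos (π / 4) * stripGFy T L (IsEpsDart L) y + (1 - y) * Real.cos (π / 8) * stripG T L y = 1 := by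
  have h := classSum_stripY (L := L) hT y
  rw [defectS_re (T := T) (L := L)] at h
  linear_combination h

/-- `2 x_c cos(π/8) = 1`. [cite: DuminilCopinSmirnov2012, §1 (x_c = 1/√(2+√2))] -/
private theorem two_xc_cos_pi_div_eight : 2 * hexCriticalFugacity * Real.cos (π / 8) = 1 := by
  have hne : Real.sqrt (2 + Real.sqrt 2) ≠ 0 := by positivity
  rw [hexCriticalFugacity, Real.cos_pi_div_eight]
  field_simp

/-- `√2 cos(π/8) = (1 + √2) x_c` (from `2 x_c cos(π/8) = 1` and `x_c²(2 + √2) = 1`). [cite: BeatonBousquetMelouDeGierDuminilCopinGuttmann2014, §4.1 (β(y) = (y*-y)/(y(y*-1)), y* = 1/(1-2x_c²) = 1+√2)] -/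
theorem sqrt_two_mul_cos_pi_div_eight :
    Real.sqrt 2 * Real.cos (π / 8) = (1 + Real.sqrt 2) * hexCriticalFugacity := by
  have hK := two_xc_cos_pi_div_eight
  have hx2 := hexCriticalFugacity_sq
  have hs : Real.sqrt 2 * Real.sqrt 2 = 2 := Real.mul_self_sqrt (by norm_num)
  have hx : 0 < hexCriticalFugacity := hexCriticalFugacity_pos_lt_one.1
  -- multiply the claim by `2 x_c > 0`
  have key : 2 * hexCriticalFugacity * (Real.sqrt 2 * Real.cos (π / 8)) =
      2 * hexCriticalFugacity * ((1 + Real.sqrt 2) * hexCriticalFugacity) := by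
    linear_combination (Real.sqrt 2) * hK - (Real.sqrt 2) * hx2 + (hexCriticalFugacity ^ 2) * hs
  exact mul_left_cancel₀ (by positivity : (2 : ℝ) * hexCriticalFugacity ≠ 0) key

/-- **Beaton–Bousquet-Mélou–de Gier–Duminil-Copin–Guttmann 2014, Proposition 4 at `n = 0` (dilute branch)** for the
strips `S_{T,L}` of the tree (`T ≥ 1`, `y > 0`), generating functions at `x = x_c` weighted `x_c^ℓ y^{c}` (`c` = visits to the
top level): `1 = cos(3π/8) A_{T,L}(x_c,y) + ((1 + √2 - y)/(√2 y)) B_{T,L}(x_c,y) + cos(π/4) E_{T,L}(x_c,y)` — "`1 = α A + ε E + β(y) B`,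
`β(y) = (y* - y)/(y(y* - 1)) = (1 + √2 - y)/(√2 y)`, `y* = 1 + √2`".  No parity hypothesis. [cite: BeatonBousquetMelouDeGierDuminilCopinGuttmann2014, Proposition 4, eq. (11) at n = 0 (arXiv:1109.0358v5 p. 7; §4.1 eq. (16) p. 13); Lemma 3 (p. 4)] [cite: DuminilCopinSmirnov2012, Lemma 1, proof of Lemma 2] -/
theorem strip_identityY {T L : ℕ} (hT : 1 ≤ T) {y : ℝ} (hy : 0 < y) :
    Real.cos (3 * π / 8) * stripGFy T L IsAlphaDart y +
        (1 + Real.sqrt 2 - y) / (Real.sqrt 2 * y) * stripGFy T L (IsBetaDart T) y +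
        Real.cos (π / 4) * stripGFy T L (IsEpsDart L) y = 1 := by
  have hm := strip_identityY_master (L := L) hT y
  have hB := stripGFy_beta_eq (L := L) hT y
  have hsc := sqrt_two_mul_cos_pi_div_eight
  have hs0 : (0 : ℝ) < Real.sqrt 2 := Real.sqrt_pos.2 (by norm_num)
  have hcoef : (1 + Real.sqrt 2 - y) / (Real.sqrt 2 * y) * (hexCriticalFugacity * y) =
      hexCriticalFugacity * y + (1 - y) * Real.cos (π / 8) := by
    rw [div_mul_eq_mul_div, div_eq_iff (by positivity)]
    linear_combination (y ^ 2 - y) * hsc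
  have step : (1 + Real.sqrt 2 - y) / (Real.sqrt 2 * y) * stripGFy T L (IsBetaDart T) y =
      stripGFy T L (IsBetaDart T) y + (1 - y) * Real.cos (π / 8) * stripG T L y := by
    rw [hB, show (1 + Real.sqrt 2 - y) / (Real.sqrt 2 * y) * (hexCriticalFugacity * y * stripG T L y) =
      ((1 + Real.sqrt 2 - y) / (Real.sqrt 2 * y) * (hexCriticalFugacity * y)) * stripG T L y by ring, hcoef]
    ring
  rw [step]
  linear_combination hm

/-- **Below `y* = 1 + √2` the walks to the surface are bounded**: for `0 < y < 1 + √2` and `T ≥ 1`,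
`B_{T,L}(x_c, y) ≤ √2 y/(1 + √2 - y)`, uniformly in `T, L` (arXiv v1 (2011) wording: "If, in addition, `y < y*`, the coefficients
`α, ε` and `β(y)` are positive, and (the identity) shows that the values of `A_{T,L}` and `B_{T,L}` are bounded"; v5 p. 14 argues at
`y = y*`: "this means that `y* ≤ y_T`"). [cite: BeatonBousquetMelouDeGierDuminilCopinGuttmann2014, Proposition 4 and §4.1–4.2 (coefficients positive for y < y*, arXiv:1109.0358v5 pp. 7, 13; §4.2 p. 14, the sentence before eq. (17): "this means that y* ≤ y_T")] -/
theorem stripGFy_beta_le {T L : ℕ} (hT : 1 ≤ T) {y : ℝ} (hy : 0 < y) (hlt : y < 1 + Real.sqrt 2) :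
    stripGFy T L (IsBetaDart T) y ≤ Real.sqrt 2 * y / (1 + Real.sqrt 2 - y) := by
  have hid := strip_identityY (L := L) hT hy
  have hs0 : (0 : ℝ) < Real.sqrt 2 := Real.sqrt_pos.2 (by norm_num)
  have hnn : ∀ (cls : HV × HV → Prop) [DecidablePred cls], 0 ≤ stripGFy T L cls y := fun cls _ =>
    sum_nonneg fun _ _ => mul_nonneg (pow_nonneg hexCriticalFugacity_pos_lt_one.1.le _) (pow_nonneg hy.le _)
  have cα : 0 ≤ Real.cos (3 * π / 8) := Real.cos_nonneg_of_mem_Icc ⟨by linarith [Real.pi_pos], by linarith [Real.pi_pos]⟩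
  have cε : 0 ≤ Real.cos (π / 4) := Real.cos_nonneg_of_mem_Icc ⟨by linarith [Real.pi_pos], by linarith [Real.pi_pos]⟩
  have hβ : 0 < (1 + Real.sqrt 2 - y) / (Real.sqrt 2 * y) := div_pos (by linarith) (by positivity)
  have hle : (1 + Real.sqrt 2 - y) / (Real.sqrt 2 * y) * stripGFy T L (IsBetaDart T) y ≤ 1 := by
    nlinarith [mul_nonneg cα (hnn IsAlphaDart), mul_nonneg cε (hnn (IsEpsDart L))]
  rw [le_div_iff₀ (by linarith : (0 : ℝ) < 1 + Real.sqrt 2 - y)]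
  have := mul_le_mul_of_nonneg_right hle (by positivity : (0 : ℝ) ≤ Real.sqrt 2 * y)
  calc stripGFy T L (IsBetaDart T) y * (1 + Real.sqrt 2 - y)
      = (1 + Real.sqrt 2 - y) / (Real.sqrt 2 * y) * stripGFy T L (IsBetaDart T) y * (Real.sqrt 2 * y) := by
        field_simp
    _ ≤ 1 * (Real.sqrt 2 * y) := this
    _ = Real.sqrt 2 * y := one_mul _

/-! ### The door's typed faces (a-idea-1 gen 17, ROUTES-G17 §1 «HEX-YC-DCS»), closed by name -/

/-- `y* = 1 + √2`. [cite: BeatonBousquetMelouDeGierDuminilCopinGuttmann2014, Theorem 2 (arXiv v5 p. 3) and Proposition 4 (y* = 1/(1 - 2x_c²), p. 7)] -/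
def yStar : ℝ := 1 + Real.sqrt 2

/-- `β(y) = (y* − y)/(y (y* − 1)) = (1 + √2 − y)/(√2 y)`. [cite: BeatonBousquetMelouDeGierDuminilCopinGuttmann2014, Proposition 4 eq. (11) (arXiv v5 p. 7) and §4.1 eq. (16) (p. 13)] -/
def betaY (y : ℝ) : ℝ := (1 + Real.sqrt 2 - y) / (Real.sqrt 2 * y)

/-- `β(1) = 1`: at `y = 1` the identity is DCS's Lemma 2. [cite: DuminilCopinSmirnov2012, Lemma 2] -/
theorem betaY_one : betaY 1 = 1 := by
  have h : Real.sqrt 2 ≠ 0 := by positivity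
  unfold betaY; field_simp; ring

/-- **Face Y1′ «STRIP-IDENTITY-Y»** (a-idea-1 gen 17's typed statement, verbatim over `stripGFy`/`betaY`): BBdGDCG Proposition 4 at
`n = 0` — `cos(3π/8) A_{T,L}(x_c,y) + cos(π/4) E_{T,L}(x_c,y) + β(y) B_{T,L}(x_c,y) = 1` for all `T ≥ 1`, `L`, `y > 0`.
[cite: BeatonBousquetMelouDeGierDuminilCopinGuttmann2014, Proposition 4, eq. (11) at n = 0 (arXiv v5 p. 7; §4.1 eq. (16) p. 13)] -/
def StripIdentityY : Prop :=
  ∀ (T L : ℕ) (y : ℝ), 1 ≤ T → 0 < y →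
    Real.cos (3 * Real.pi / 8) * stripGFy T L IsAlphaDart y + Real.cos (Real.pi / 4) * stripGFy T L (IsEpsDart L) y +
        betaY y * stripGFy T L (IsBetaDart T) y = 1

/-- Y1′ holds (`strip_identityY`). [cite: BeatonBousquetMelouDeGierDuminilCopinGuttmann2014, Proposition 4, eq. (11) at n = 0 (arXiv v5 p. 7)] -/
theorem stripIdentityY_holds : StripIdentityY := by
  intro T L y hT hy
  have h := strip_identityY (L := L) hT hy
  unfold betaY
  linear_combination h

/-- **Target Y-LOWER′** (a-idea-1 gen 17's typed statement; BBdGDCG §4.2, the `y* ≤ y_T` half): for `0 < y < y*`,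
`β(y) · B_{T,L}(x_c,y) ≤ 1` uniformly in `T ≥ 1` and `L`. [cite: BeatonBousquetMelouDeGierDuminilCopinGuttmann2014, §4.2 (arXiv v5 p. 14, the sentence before eq. (17): "this means that y* ≤ y_T")] -/
def StripByBound : Prop :=
  ∀ (T L : ℕ) (y : ℝ), 1 ≤ T → 0 < y → y < yStar → betaY y * stripGFy T L (IsBetaDart T) y ≤ 1

/-- Y-LOWER′ holds: the other two terms of the identity are nonnegative. [cite: BeatonBousquetMelouDeGierDuminilCopinGuttmann2014, §4.2 (arXiv v1 (2011) wording: "the coefficients α, ε and β(y) are positive, and (16) shows that … B_{T,L}(x_c,y) remain bounded"; v5 p. 14 states the boundedness at y = y*)] -/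
theorem stripByBound_holds : StripByBound := by
  intro T L y hT hy _
  have hid := strip_identityY (L := L) hT hy
  have hnn : ∀ (cls : HV × HV → Prop) [DecidablePred cls], 0 ≤ stripGFy T L cls y := fun cls _ =>
    sum_nonneg fun _ _ => mul_nonneg (pow_nonneg hexCriticalFugacity_pos_lt_one.1.le _) (pow_nonneg hy.le _)
  have cα : 0 ≤ Real.cos (3 * π / 8) := Real.cos_nonneg_of_mem_Icc ⟨by linarith [Real.pi_pos], by linarith [Real.pi_pos]⟩
  have cε : 0 ≤ Real.cos (π / 4) := Real.cos_nonneg_of_mem_Icc ⟨by linarith [Real.pi_pos], by linarith [Real.pi_pos]⟩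
  unfold betaY
  nlinarith [mul_nonneg cα (hnn IsAlphaDart), mul_nonneg cε (hnn (IsEpsDart L))]

end HV

end Literature.Probability.RandomPlanarGeometry.SAW
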